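import Literature.MathematicalPhysics.QuantumFieldTheory.Balaban1983to89.B8Thm2TorusMemberCatalogue
import Literature.MathematicalPhysics.QuantumFieldTheory.Balaban1983to89.B6KLevelFamilyWitnessV1
import Literature.MathematicalPhysics.QuantumFieldTheory.Balaban1983to89.Node00.OpsYOfLetters

/-!
# Balaban [4] (2.3) p. 224 ∕ (2.45) p. 231, «sites replaced by bonds» p. 248 — THE SECTION-CARRYING SUB-FAMILY OF def-Y's MEMBERS: the subtype
# `{x : MemberY … // β_x onto 𝔅}` with its CANONICAL sections `ιB := surjInv`, `β (ιB s) = s`, NON-EMPTY at every `M⋆` (constant-level members) — the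
# carrier for the (α5) re-instantiation of the N06 ∕ N24 faces after LOCATED-19 (seat dag-n06-c g18; count-neutral)

T. Bałaban, *Propagators and renormalization transformations for lattice gauge theories. II*, Commun. Math. Phys. **96** (1984) 223–250 [`Balaban1984PropagatorsII`,
"[4]"], (2.1)–(2.4) p. 224, (2.45) p. 231, p. 248; T. Bałaban, *Propagators for lattice gauge theories in a background field*, Commun. Math. Phys. **99** (1985)
389–434 [`Balaban1985BackgroundPropagators`, "B9"], Thm 3.4 p. 400, (3.48) p. 398 (block-indexed statements read at carrier blocks).

statement-level skeleton of published theorems with citation tags; proofs where landed; nothing here is a claim about the Yang–Mills mass gap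

WHY THIS FILE (cell context).  `B9BetaNotchMemberV1.not_exists_sections_memberY` (this seat, LOCATED-19's kernel witness): NO family of sections
`ιB : ∀ x : MemberY …, BlkY x → IBondY x`, `β (ιB x s) = s`, exists over the WHOLE member type — so a face that instantiates the (α3) block of the N06 certificate
(`B9SectBStepUClosedSUOfSections.sectBStepU_C37GY_su_extraYPb_closed`: a sub-family `f : J → MemberY` WITH sections `ιB hι`) at `J := MemberY`, `f := id` has an
unsatisfiable display (the (α4) face p731579).  The agreed cure (α5) (dag-n06-c ∕ ref-H g33 ∕ dag-lead WORDS 69, 2026-08-29) instantiates at the SECTION-CARRYING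
sub-family instead.  THIS FILE is that carrier, once and for all: the subtype `SCMemberY`, its projection `val`, the canonical sections `ιBsc` with `hιsc` BY
CONSTRUCTION (`Function.surjInv`), and its NON-EMPTINESS at every `M⋆` beyond every threshold (a constant-level member, `B8Thm2TorusMemberCatalogue.exists_constLev_member`
∕ `surjective_beta_kIdx_of_constLev`, read through `MemberY.diag`) — so ref-A's «instantiate a NON-EMPTY `J`» caveat stays honoured and the binders `ιB hι` leave
the face's display altogether.  dag-n06-j g31's offered `surjective_beta_of_boxLevels` (every box-level family is section-carrying) enlarges the known part of the
subtype; inner-corner members (the notch of `B9BetaNotchMemberV1`) are outside it by definition.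

WHAT IS PROVED ∕ DEFINED (sorry-free; standard axioms; 2 `def`: the subtype `SCMemberY` and its sections `ιBsc`; no `instance`, no `def … : Prop`).
* `SCMemberY d ℓ hd hL b₀ b₁ M⋆` (the subtype), `SCMemberY.val`, `SCMemberY.surjective_beta`, ★ `SCMemberY.ιBsc` ∕ ★ `SCMemberY.hιsc` (the (α3) block's `ιB hι` SUPPLIED),
  ★ `exists_member_surjective_beta` (`∀ M⋆ M₁, ∃ x : MemberY …, M₁ ≤ M ∧ Surjective β_x` — odd `L ≥ 5`, `0 < b₀ ≤ b₁`), ★ `SCMemberY.nonempty`,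
  `exists_scMember_ge` (members of the subtype beyond every `M`-threshold — the thresholds `M_∙ ≤ (geo9Y x).M` of the faces are met inside the subtype).

HONEST SCOPE.  Bookkeeping over landed constructions; nothing of [B9] ∕ [4] asserted; which member class the K1 consumer NEEDS (all `TDomains` families vs the
section-carrying ones) is node00-def-Y's ∕ the director's word (def-Y g28: the design intends W⁺, i.e. the whole type — so faces over `SCMemberY` are HONESTLY
NARROWER than «every member» and say so); COUNT-NEUTRAL; N06 ∕ N24 NOT discharged; nothing continuum ∕ OS ∕ mass gap ∕ Clay.  Cell `pub-ymgap` (HUMAN RULING D-0062),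
Track A nodes N06 [B9] ∕ N24, seat `pub-ymgap-dag-n06-c` g18, 2026-08-29.  NEW file; nothing landed is modified.  Net new unproved facts: 0.
-/

noncomputable section

namespace Literature.MathematicalPhysics.QuantumFieldTheory.Balaban1983to89.B9SectionCarryingMembersV1

open B6KLevelCensusIndexV1 (KIdx)
open B6KLevelFamilyWitnessV1 (exists_exponent)
open B6Ineq2142KLevelV1 (β)
open B9PinMembersKLevelV1 (MemberY geo9Y)
open B8Thm2TorusMemberCatalogue (exists_constLev_member)
open Node00 (BlkY IBondY)

variable (d ℓ : ℕ) (hd : 1 ≤ d + 1) (hL : Odd (ℓ + 1) ∧ 1 < ℓ + 1) (b₀ b₁ : ℝ) (Mstar : ℕ)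

/-- **THE SECTION-CARRYING SUB-FAMILY**: members whose carrier-block map `β` is onto `𝔅` (no inner corner, `B9BetaRangeKLevelV1.surjective_beta_iff`).
[cite: Balaban1984PropagatorsII, (2.3) p.224 + (2.45) p.231; p.248 («sites replaced by bonds»)] -/
def SCMemberY : Type :=
  {x : MemberY d ℓ hd hL b₀ b₁ Mstar // Function.Surjective (β x.toKIdx.hN x.toKIdx.D x.toKIdx.hk)}

namespace SCMemberY

variable {d ℓ hd hL b₀ b₁ Mstar}

/-- the underlying member (the (α3) block's `f := SCMemberY.val`). [cite: Balaban1984PropagatorsII, (2.1) p.224, bookkeeping] -/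
def val (j : SCMemberY d ℓ hd hL b₀ b₁ Mstar) : MemberY d ℓ hd hL b₀ b₁ Mstar := j.1

/-- its carrier-block map is onto. [cite: Balaban1984PropagatorsII, (2.3) p.224 + (2.45) p.231] -/
theorem surjective_beta (j : SCMemberY d ℓ hd hL b₀ b₁ Mstar) :
    Function.Surjective (β j.val.toKIdx.hN j.val.toKIdx.D j.val.toKIdx.hk) := j.2

/-- ★ **THE CANONICAL SECTIONS** `ιB j : BlkY (val j) → IBondY (val j)` (a right inverse of `β`, by choice). [cite: Balaban1984PropagatorsII, (2.3) p.224 + (2.45) p.231] -/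
def ιBsc (j : SCMemberY d ℓ hd hL b₀ b₁ Mstar) : BlkY j.val.toKIdx → IBondY j.val.toKIdx :=
  Function.surjInv j.surjective_beta

/-- ★ `β (ιB j s) = s` — the (α3) block's binder `hι`, BY CONSTRUCTION. [cite: Balaban1984PropagatorsII, (2.3) p.224 + (2.45) p.231] -/
theorem hιsc (j : SCMemberY d ℓ hd hL b₀ b₁ Mstar) (s : BlkY j.val.toKIdx) :
    β j.val.toKIdx.hN j.val.toKIdx.D j.val.toKIdx.hk (ιBsc j s) = s :=
  Function.surjInv_eq j.surjective_beta s

end SCMemberY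

variable {d ℓ hd hL b₀ b₁}

/-- ★ **SECTION-CARRYING MEMBERS EXIST AT EVERY `M⋆`, BEYOND EVERY THRESHOLD**: the constant-level member (`lev ≡ 1`, nominal `k = 2`) of
`B8Thm2TorusMemberCatalogue.exists_constLev_member` with `M_h = Lᵃ` large, read as a `MemberY` through `MemberY.diag` (odd `L ≥ 5`, `0 < b₀ ≤ b₁`).
[cite: Balaban1984PropagatorsII, (2.1)–(2.4) p.224 («We admit the case when some domains Ω_j are equal to T_η»), (2.45) p.231] -/
theorem exists_member_surjective_beta (hℓ : 4 ≤ ℓ) (Mstar : ℕ) (M₁ : ℝ) (hb₀ : 0 < b₀) (hb₁ : b₀ ≤ b₁) :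
    ∃ x : MemberY d ℓ hd hL b₀ b₁ Mstar, M₁ ≤ (geo9Y x).M ∧ Function.Surjective (β x.toKIdx.hN x.toKIdx.D x.toKIdx.hk) := by
  obtain ⟨a, h8, hM₂, -⟩ := exists_exponent ℓ (by omega) (max M₁ (Mstar : ℝ)) 0 1 le_rfl
  obtain ⟨i, -, -, -, hMh, hcf, -, hsurj⟩ :=
    exists_constLev_member (d := d) (hd := hd) (hL := hL) hℓ hb₀ hb₁ (T := (1 + 1) + a + 1 + 1) (n := 1) (a := a) (s := 1) le_rfl h8 le_rfl rfl
  have hM : max M₁ (Mstar : ℝ) ≤ ((ℓ : ℝ) + 1) * (i.Mh : ℝ) := by rw [hMh]; exact_mod_cast hM₂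
  have hMstar : Mstar ≤ (ℓ + 1) * i.Mh := by
    have h : (Mstar : ℝ) ≤ ((ℓ : ℝ) + 1) * (i.Mh : ℝ) := le_trans (le_max_right _ _) hM
    have h' : ((Mstar : ℕ) : ℝ) ≤ (((ℓ + 1) * i.Mh : ℕ) : ℝ) := by push_cast; linarith
    exact_mod_cast h'
  refine ⟨MemberY.diag i hcf hMstar, ?_, hsurj⟩
  show M₁ ≤ (((ℓ + 1 : ℕ) : ℝ)) * (i.Mh : ℝ)
  have hcast : (((ℓ + 1 : ℕ) : ℝ)) = (ℓ : ℝ) + 1 := by push_cast; ring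
  rw [hcast]; exact le_trans (le_max_left _ _) hM

/-- ★ the section-carrying sub-family is NON-EMPTY at every `M⋆` (ref-A's «non-empty `J`» caveat for faces instantiated at `SCMemberY`).
[cite: Balaban1984PropagatorsII, (2.1)–(2.4) p.224, (2.45) p.231] -/
theorem SCMemberY.nonempty (hℓ : 4 ≤ ℓ) (hb₀ : 0 < b₀) (hb₁ : b₀ ≤ b₁) : Nonempty (SCMemberY d ℓ hd hL b₀ b₁ Mstar) := by
  obtain ⟨x, -, hx⟩ := exists_member_surjective_beta (d := d) (hd := hd) (hL := hL) hℓ Mstar 0 hb₀ hb₁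
  exact ⟨⟨x, hx⟩⟩

/-- members of the sub-family exist beyond every `M`-threshold (the faces' `M_∙ ≤ (geo9Y x).M` guards are met INSIDE the subtype).
[cite: Balaban1984PropagatorsII, Prop. 2.2 p.234 («M is sufficiently large»), bookkeeping] -/
theorem exists_scMember_ge (hℓ : 4 ≤ ℓ) (M₁ : ℝ) (hb₀ : 0 < b₀) (hb₁ : b₀ ≤ b₁) :
    ∃ j : SCMemberY d ℓ hd hL b₀ b₁ Mstar, M₁ ≤ (geo9Y j.val).M := by
  obtain ⟨x, hM, hx⟩ := exists_member_surjective_beta (d := d) (hd := hd) (hL := hL) hℓ Mstar M₁ hb₀ hb₁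
  exact ⟨⟨x, hx⟩, hM⟩

end Literature.MathematicalPhysics.QuantumFieldTheory.Balaban1983to89.B9SectionCarryingMembersV1

end
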